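import Mathlib

/-!
# `BalabanUV.Beta.GAN24.AliasWeights` — binder row G-an2-4 / (CONV-C), road P1-fibre, leaf **P1-L06** (node A2 / N06 of
# `SKELETON-P1.md`): geometric-sum ALIAS WEIGHTS of the block averages and the uniform alias-sum bound

NOT IN PRINT; OUR PROOF ATTEMPT.  HONEST FRAMING (cell contract, verbatim): «discharging `BetaPertH` makes Bałaban's UV stability
UNCONDITIONAL — a real constructive-QFT result; it is NOT the continuum limit and NOT the Clay problem.»  HONEST DEPENDENCY (verbatim):
«continuum YM on T⁴ ⇐ BetaPertH ∧ nine spine estimates (0/9 proved); BetaPertH ⇐ (D1) ∧ (D4) ∧ CAP+tail; G-an2-4 gates asym, D1 and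
NE2/3/4.»  This leaf is [folklore] explicit analysis (geometric sums, Jordan's inequality, `Σ 1/v² ≤ 2`); it discharges NOTHING of
(CONV-C) by itself: it is the weight bookkeeping consumed by the capacitance / endpoint / rate leaves P1-L05, L08, L09, L11 of the
`LEMMAS.md § GAN24 SKELETON-P1 LEAF CLAIM TABLE`.  NOT `BetaPertH`, NOT continuum, NOT Clay.  No `def … : Prop`, no cited fact, no wall binder.

## The objects (SKELETON-P1 S1a/S1c, A2)
For a box of side `N`, a Brillouin momentum `p ∈ [−π, π]^D` and an alias `m ∈ (ℤ/N)^D` (box representative `val (m i) ∈ [0, N)`, i.e.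
`BlochPeriodicCochains.repZ`), the FINE MOMENTUM is `k_{m,i} = (p_i + 2π·val(m_i))/N` (`kfine`).  The block-average weights of the
Q/M rows and of the leg readings are products of the geometric sums `G(x, N) = Σ_{t<N} e^{ixt}` at `x = k_{m,i}`:
`S(m) = Π_i G(k_{m,i}, N)`, `s_κ(m) = G(k_{m,κ}, N)`, and the `M`-versions `S_M`, `s_{M,κ}` with `G(·, M)` at the SAME fine momenta.
The geometric sums are written here on the explicit `Finset.range` sum (the `FibreSymbols.gsum` of gan24-p1's v1.1, p199485, was still
pending at the gate when this leaf was written; the statements below are about `∑ t ∈ Finset.range N, cexp (I * z * t)` verbatim).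

## What is proved (Mathlib only; every constant explicit)
* §1 geometric sums: `geomExp_mul_sub_one` (`G(z,N)·(e^{iz} − 1) = e^{izN} − 1`, complex `z`), `norm_geomExp_le` (`‖G(x,N)‖ ≤ N`, real
  `x`), `norm_geomExp_le_of_im` (STRIP version `‖G(z,N)‖ ≤ N·e^η` whenever `|Im z|·N ≤ η`), `norm_geomExp_le_inv_sin`
  (`‖G(x,N)‖ ≤ 1/|sin(x/2)|`, real `x`, `sin(x/2) ≠ 0`), and the squared WEIGHT form `‖G(x,N)‖² ≤ N²·sinWt N x` with the
  division-safe one-coordinate weight `sinWt N x = 1/max(1, (N sin(x/2))²) = min(1, (N sin(x/2))⁻²)`; weight PRODUCTS for `S`,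
  `S·s_κ` (`norm_prod_geomExp_sq_le`, `norm_prod_geomExp_mul_sq_le`) and the change of box `sinWt M x ≤ (N/M)²·sinWt N x`
  (`sinWt_le_sq_mul_sinWt`, `0 < M ≤ N`: the `S_M`, `s_{M,κ}` weights are controlled by the `N`-weights at the cost `Lc²` per factor).
* §2 Jordan: `(2/π)·min(x, π − x) ≤ sin x` on `[0, π]` and, for `|p| ≤ π`, `1 ≤ r ≤ N − 1`:
  `min(r, N − r) ≤ N·|sin(k/2)|`, `k = (p + 2πr)/N` (`fold_le_mul_abs_sin`) — every NONZERO alias coordinate carries a weight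
  `sinWt ≤ min(r, N−r)⁻² ≤ r⁻² + (N − r)⁻²` (`sinWt_kfine_le_wMaj`), and `4 ≤ N²·L(k_m)` for `m ≠ 0` (`four_le_sq_mul_lapR`).
* §3 (in the companion module `GAN24/AliasWeightsSum`, same leaf): the real Laplacian symbol `lapR` = `FibreSymbols.lapSym` at real
  momenta, and the **UNIFORM ALIAS-SUM BOUND** `Σ_{m ∈ (ℤ/N)^D, m ≠ 0} (Π_i sinWt N k_{m,i}) / (N²·lapR k_m) ≤ (5^D − 1)/4` with its tail form.

Unit `b2b-balaban-gan24-formalise-leaf-17` (G-an2-4 formalisation swarm, leaf prover 17), 2026-08-19.  Value = kernel bookkeeping leaf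
toward the K-slot route P1, NOT summit progress.
-/

noncomputable section

open Complex Finset
open scoped BigOperators Real

namespace Summit.QuantumFields.BalabanUV.Beta.GAN24.AliasWeights

variable {D : ℕ}

/-! ## §1  Geometric sums `G(z, N) = Σ_{t<N} e^{izt}` and the one-coordinate weight `sinWt` -/

/-- [folklore] `e^{izt} = (e^{iz})^t` for a natural `t`. -/
theorem cexp_I_mul_mul_nat (z : ℂ) (t : ℕ) : cexp (I * z * t) = cexp (I * z) ^ t := by
  rw [← Complex.exp_nat_mul]
  congr 1
  ring

/-- [folklore] The geometric-sum identity `G(z,N)·(e^{iz} − 1) = e^{izN} − 1` (any complex `z`). -/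
theorem geomExp_mul_sub_one (z : ℂ) (N : ℕ) :
    (∑ t ∈ Finset.range N, cexp (I * z * t)) * (cexp (I * z) - 1) = cexp (I * z * N) - 1 := by
  simp_rw [cexp_I_mul_mul_nat]
  exact geom_sum_mul _ _

/-- [folklore] `‖e^{izt}‖ = e^{−(Im z)·t}`. -/
theorem norm_cexp_I_mul_mul_nat (z : ℂ) (t : ℕ) : ‖cexp (I * z * t)‖ = Real.exp (-(z.im * t)) := by
  rw [Complex.norm_exp]
  congr 1
  simp [Complex.mul_re, Complex.mul_im]

/-- [folklore] STRIP BOUND: if `|Im z|·N ≤ η` then `‖G(z,N)‖ ≤ N·e^η` (each of the `N` terms has modulus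
`e^{−(Im z)t} ≤ e^{|Im z|·N} ≤ e^η`). -/
theorem norm_geomExp_le_of_im (z : ℂ) (N : ℕ) {η : ℝ} (hη : |z.im| * N ≤ η) :
    ‖∑ t ∈ Finset.range N, cexp (I * z * t)‖ ≤ N * Real.exp η := by
  calc ‖∑ t ∈ Finset.range N, cexp (I * z * t)‖
      ≤ ∑ t ∈ Finset.range N, ‖cexp (I * z * t)‖ := norm_sum_le _ _
    _ ≤ ∑ _t ∈ Finset.range N, Real.exp η := by
        refine Finset.sum_le_sum fun t ht => ?_
        rw [norm_cexp_I_mul_mul_nat]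
        refine Real.exp_le_exp.2 ?_
        have ht' : (t : ℝ) ≤ N := by exact_mod_cast (Finset.mem_range.1 ht).le
        have ht0 : (0 : ℝ) ≤ t := Nat.cast_nonneg t
        have h1 : -(z.im * t) ≤ |z.im| * t := by
          have := neg_abs_le z.im
          nlinarith
        have h2 : |z.im| * t ≤ |z.im| * N := mul_le_mul_of_nonneg_left ht' (abs_nonneg _)
        linarith
    _ = N * Real.exp η := by rw [Finset.sum_const, Finset.card_range, nsmul_eq_mul]

/-- [folklore] `‖G(x,N)‖ ≤ N` for REAL `x` (every term is unimodular). -/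
theorem norm_geomExp_le (x : ℝ) (N : ℕ) : ‖∑ t ∈ Finset.range N, cexp (I * x * t)‖ ≤ N := by
  calc ‖∑ t ∈ Finset.range N, cexp (I * x * t)‖
      ≤ ∑ t ∈ Finset.range N, ‖cexp (I * x * t)‖ := norm_sum_le _ _
    _ = N := by
        have h : ∀ t ∈ Finset.range N, ‖cexp (I * (x : ℂ) * t)‖ = 1 := fun t _ => by
          rw [show I * (x : ℂ) * (t : ℂ) = I * ((x * t : ℝ) : ℂ) by push_cast; ring, Complex.norm_exp_I_mul_ofReal]
        rw [Finset.sum_congr rfl h, Finset.sum_const, Finset.card_range, nsmul_eq_mul, mul_one]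

/-- [folklore] `‖G(x,N)‖ ≤ 1/|sin(x/2)|` for real `x ∉ 2πℤ` (i.e. `sin(x/2) ≠ 0`): from `G·(e^{ix} − 1) = e^{ixN} − 1`,
`‖e^{ixN} − 1‖ ≤ 2` and `‖e^{ix} − 1‖ = 2|sin(x/2)|`. -/
theorem norm_geomExp_le_inv_sin (x : ℝ) (N : ℕ) (hx : Real.sin (x / 2) ≠ 0) :
    ‖∑ t ∈ Finset.range N, cexp (I * x * t)‖ ≤ 1 / |Real.sin (x / 2)| := by
  have hs : 0 < |Real.sin (x / 2)| := abs_pos.2 hx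
  have hid := geomExp_mul_sub_one (x : ℂ) N
  have h2 : ‖cexp (I * x * N) - 1‖ ≤ 2 := by
    calc ‖cexp (I * x * N) - 1‖ ≤ ‖cexp (I * (x : ℂ) * N)‖ + ‖(1 : ℂ)‖ := norm_sub_le _ _
      _ = 2 := by
          rw [show I * (x : ℂ) * (N : ℂ) = I * ((x * N : ℝ) : ℂ) by push_cast; ring, Complex.norm_exp_I_mul_ofReal, norm_one]
          norm_num
  have hnorm : ‖cexp (I * x) - 1‖ = 2 * |Real.sin (x / 2)| := by
    rw [Complex.norm_exp_I_mul_ofReal_sub_one, Real.norm_eq_abs, abs_mul, abs_two]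
  have hprod : ‖∑ t ∈ Finset.range N, cexp (I * x * t)‖ * (2 * |Real.sin (x / 2)|) ≤ 2 := by
    rw [← hnorm, ← norm_mul, hid]
    exact h2
  rw [le_div_iff₀ hs]
  nlinarith [norm_nonneg (∑ t ∈ Finset.range N, cexp (I * x * t))]

/-- The one-coordinate ALIAS WEIGHT `min(1, (N·sin(x/2))⁻²)`, written division-safely as `1 / max(1, (N·sin(x/2))²)`
(so that it is `1`, not `0`, where `sin(x/2) = 0`). -/
def sinWt (N : ℕ) (x : ℝ) : ℝ := 1 / max 1 (((N : ℝ) * Real.sin (x / 2)) ^ 2)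

/-- [folklore] `0 < sinWt N x`. -/
theorem sinWt_pos (N : ℕ) (x : ℝ) : 0 < sinWt N x := by
  unfold sinWt
  exact div_pos one_pos (lt_of_lt_of_le one_pos (le_max_left _ _))

/-- [folklore] `sinWt N x ≤ 1`. -/
theorem sinWt_le_one (N : ℕ) (x : ℝ) : sinWt N x ≤ 1 := by
  unfold sinWt
  rw [div_le_one (lt_of_lt_of_le one_pos (le_max_left _ _))]
  exact le_max_left _ _

/-- [folklore] `sinWt N x ≤ 1/a²` whenever `0 < a ≤ N·|sin(x/2)|`. -/
theorem sinWt_le_inv_sq {N : ℕ} {x a : ℝ} (ha : 0 < a) (hle : a ≤ (N : ℝ) * |Real.sin (x / 2)|) :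
    sinWt N x ≤ 1 / a ^ 2 := by
  unfold sinWt
  have h1 : a ^ 2 ≤ ((N : ℝ) * Real.sin (x / 2)) ^ 2 := by
    rw [← sq_abs ((N : ℝ) * _), abs_mul, Nat.abs_cast]
    exact pow_le_pow_left₀ ha.le hle 2
  exact one_div_le_one_div_of_le (pow_pos ha 2) (h1.trans (le_max_right _ _))

/-- [folklore] SQUARED WEIGHT FORM: `‖G(x,N)‖² ≤ N²·sinWt N x`, i.e. `‖G(x,N)‖ ≤ min(N, 1/|sin(x/2)|)` for real `x`. -/
theorem norm_geomExp_sq_le (x : ℝ) (N : ℕ) :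
    ‖∑ t ∈ Finset.range N, cexp (I * x * t)‖ ^ 2 ≤ (N : ℝ) ^ 2 * sinWt N x := by
  set A := ‖∑ t ∈ Finset.range N, cexp (I * x * t)‖ with hA
  have hA0 : 0 ≤ A := norm_nonneg _
  have hAN : A ≤ N := norm_geomExp_le x N
  unfold sinWt
  rcases le_or_gt (((N : ℝ) * Real.sin (x / 2)) ^ 2) 1 with h | h
  · rw [max_eq_left h, div_one, mul_one]
    exact pow_le_pow_left₀ hA0 hAN 2
  · rw [max_eq_right h.le]
    have hs : Real.sin (x / 2) ≠ 0 := by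
      intro h0
      rw [h0, mul_zero] at h
      norm_num at h
    have hs' : 0 < |Real.sin (x / 2)| := abs_pos.2 hs
    have hAs : A ≤ 1 / |Real.sin (x / 2)| := norm_geomExp_le_inv_sin x N hs
    calc A ^ 2 ≤ (1 / |Real.sin (x / 2)|) ^ 2 := pow_le_pow_left₀ hA0 hAs 2
      _ = (N : ℝ) ^ 2 * (1 / ((N : ℝ) * Real.sin (x / 2)) ^ 2) := by
          have hN : (N : ℝ) ≠ 0 := by
            intro h0
            rw [h0, zero_mul] at h
            norm_num at h
          rw [div_pow, one_pow, sq_abs]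
          field_simp

/-- [folklore] WEIGHT PRODUCT for `S(m) = Π_i G(x_i, N)` (resp. `S_M` with `N ↦ M`): `‖Π_i G(x_i,N)‖² ≤ (N²)^D · Π_i sinWt N x_i`. -/
theorem norm_prod_geomExp_sq_le (x : Fin D → ℝ) (N : ℕ) :
    ‖∏ i, ∑ t ∈ Finset.range N, cexp (I * (x i) * t)‖ ^ 2 ≤ ((N : ℝ) ^ 2) ^ D * ∏ i, sinWt N (x i) := by
  rw [norm_prod, ← Finset.prod_pow,
    show ((N : ℝ) ^ 2) ^ D = ∏ _i : Fin D, (N : ℝ) ^ 2 by rw [Finset.prod_const, Finset.card_univ, Fintype.card_fin],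
    ← Finset.prod_mul_distrib]
  exact Finset.prod_le_prod (fun i _ => by positivity) fun i _ => norm_geomExp_sq_le (x i) N

/-- [folklore] WEIGHT PRODUCT for the Q-row / leg weights `S(m)·s_κ(m)`:
`‖(Π_i G(x_i,N))·G(x_κ,N)‖² ≤ (N²)^D·N² · (Π_i sinWt N x_i)·sinWt N x_κ`. -/
theorem norm_prod_geomExp_mul_sq_le (x : Fin D → ℝ) (κ : Fin D) (N : ℕ) :
    ‖(∏ i, ∑ t ∈ Finset.range N, cexp (I * (x i) * t)) * ∑ t ∈ Finset.range N, cexp (I * (x κ) * t)‖ ^ 2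
      ≤ ((N : ℝ) ^ 2) ^ D * (N : ℝ) ^ 2 * ((∏ i, sinWt N (x i)) * sinWt N (x κ)) := by
  rw [norm_mul, mul_pow]
  have h1 := norm_prod_geomExp_sq_le x N
  have h2 := norm_geomExp_sq_le (x κ) N
  calc ‖∏ i, ∑ t ∈ Finset.range N, cexp (I * (x i) * t)‖ ^ 2 * ‖∑ t ∈ Finset.range N, cexp (I * (x κ) * t)‖ ^ 2
      ≤ (((N : ℝ) ^ 2) ^ D * ∏ i, sinWt N (x i)) * ((N : ℝ) ^ 2 * sinWt N (x κ)) :=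
        mul_le_mul h1 h2 (by positivity) (mul_nonneg (by positivity) (Finset.prod_nonneg fun _ _ => (sinWt_pos _ _).le))
    _ = _ := by ring

/-- [folklore] CHANGE OF BOX: for `0 < M ≤ N`, `sinWt M x ≤ (N/M)²·sinWt N x` — the `M`-box weights (`S_M`, `s_{M,κ}` at the
`N`-fine momenta) are controlled by the `N`-box weights at the cost `(N/M)²` (`= Lc²`) per factor. -/
theorem sinWt_le_sq_mul_sinWt {M N : ℕ} (hM : 0 < M) (hMN : M ≤ N) (x : ℝ) :
    sinWt M x ≤ ((N : ℝ) / M) ^ 2 * sinWt N x := by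
  have hM' : (0 : ℝ) < M := by exact_mod_cast hM
  have hMN' : (M : ℝ) ≤ N := by exact_mod_cast hMN
  have hq : 1 ≤ (N : ℝ) / M := by rw [le_div_iff₀ hM']; linarith
  unfold sinWt
  set s := Real.sin (x / 2) with hs
  rcases le_or_gt (((N : ℝ) * s) ^ 2) 1 with h | h
  · -- then also (M s)² ≤ 1: both weights are 1
    have hM1 : ((M : ℝ) * s) ^ 2 ≤ 1 := by
      have : ((M : ℝ) * s) ^ 2 ≤ ((N : ℝ) * s) ^ 2 := by
        rw [mul_pow, mul_pow]
        exact mul_le_mul_of_nonneg_right (pow_le_pow_left₀ hM'.le hMN' 2) (sq_nonneg _)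
      exact this.trans h
    rw [max_eq_left h, max_eq_left hM1, div_one, mul_one]
    nlinarith
  · rw [max_eq_right h.le]
    have hpos : 0 < ((M : ℝ) * s) ^ 2 := by
      have hs0 : s ≠ 0 := by
        intro h0; rw [h0, mul_zero] at h; norm_num at h
      positivity
    calc 1 / max 1 (((M : ℝ) * s) ^ 2) ≤ 1 / (((M : ℝ) * s) ^ 2) :=
          one_div_le_one_div_of_le hpos (le_max_right _ _)
      _ = ((N : ℝ) / M) ^ 2 * (1 / ((N : ℝ) * s) ^ 2) := by
          have hN : (N : ℝ) ≠ 0 := by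
            intro h0; rw [h0, zero_mul] at h; norm_num at h
          have hs0 : s ≠ 0 := by
            intro h0; rw [h0, mul_zero] at h; norm_num at h
          field_simp

/-! ## §2  Fine momenta, Jordan's inequality and the weight majorant of a nonzero alias coordinate -/

/-- The FINE MOMENTUM of the alias `m ∈ (ℤ/N)^D` at Brillouin momentum `p`, box representative `val(m_i) ∈ [0, N)`
(`= BlochPeriodicCochains.repZ m i`): `k_{m,i} = (p_i + 2π·val(m_i))/N`. -/
def kfine (N : ℕ) (p : Fin D → ℝ) (m : Fin D → ZMod N) (i : Fin D) : ℝ := (p i + 2 * π * ((m i).val : ℕ)) / N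

/-- [folklore] Concavity form of Jordan's inequality: `(2/π)·min(x, π − x) ≤ sin x` for `0 ≤ x ≤ π`. -/
theorem two_div_pi_mul_min_le_sin {x : ℝ} (h0 : 0 ≤ x) (hπ : x ≤ π) : 2 / π * min x (π - x) ≤ Real.sin x := by
  rcases le_or_gt x (π / 2) with h | h
  · calc 2 / π * min x (π - x) ≤ 2 / π * x := mul_le_mul_of_nonneg_left (min_le_left _ _) (by positivity)
      _ ≤ Real.sin x := Real.mul_le_sin h0 h
  · calc 2 / π * min x (π - x) ≤ 2 / π * (π - x) := mul_le_mul_of_nonneg_left (min_le_right _ _) (by positivity)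
      _ ≤ Real.sin (π - x) := Real.mul_le_sin (by linarith) (by linarith)
      _ = Real.sin x := Real.sin_pi_sub x

/-- [folklore] THE FOLDED LOWER BOUND: for `|p| ≤ π` and a NONZERO box coordinate `1 ≤ r ≤ N − 1`,
`min(r, N − r) ≤ N·|sin(k/2)|` with `k = (p + 2πr)/N` (here `k/2 ∈ [π/(2N), π − π/(2N)]`, and Jordan on both halves). -/
theorem fold_le_mul_abs_sin {p : ℝ} (hp : |p| ≤ π) {N r : ℕ} (hr : 1 ≤ r) (hrN : r + 1 ≤ N) :
    ((min r (N - r) : ℕ) : ℝ) ≤ (N : ℝ) * |Real.sin ((p + 2 * π * r) / N / 2)| := by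
  have hN0 : 0 < N := by omega
  have hN : (0 : ℝ) < N := by exact_mod_cast hN0
  have hπ := Real.pi_pos
  have hp1 := (abs_le.1 hp).1
  have hp2 := (abs_le.1 hp).2
  have hrR : (1 : ℝ) ≤ r := by exact_mod_cast hr
  have hrN' : (r : ℝ) + 1 ≤ N := by exact_mod_cast hrN
  set x := (p + 2 * π * r) / N / 2 with hx
  have hnum : 0 ≤ p + 2 * π * r := by nlinarith
  have hx0 : 0 ≤ x := by rw [hx]; positivity
  have hxπ : x ≤ π := by
    rw [hx, div_div, div_le_iff₀ (by positivity)]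
    nlinarith
  have hsin := two_div_pi_mul_min_le_sin hx0 hxπ
  have hsin0 : 0 ≤ Real.sin x := Real.sin_nonneg_of_nonneg_of_le_pi hx0 hxπ
  rw [abs_of_nonneg hsin0]
  have e1 : (N : ℝ) * (2 / π * x) = p / π + 2 * r := by rw [hx]; field_simp
  have e2 : (N : ℝ) * (2 / π * (π - x)) = 2 * N - (p / π + 2 * r) := by rw [hx]; field_simp
  have hpπ1 : -1 ≤ p / π := by rw [le_div_iff₀ hπ]; linarith
  have hpπ2 : p / π ≤ 1 := by rw [div_le_iff₀ hπ]; linarith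
  rcases le_total x (π - x) with hle | hle
  · rw [min_eq_left hle] at hsin
    have hmin : ((min r (N - r) : ℕ) : ℝ) ≤ r := by exact_mod_cast Nat.min_le_left _ _
    calc ((min r (N - r) : ℕ) : ℝ) ≤ r := hmin
      _ ≤ (N : ℝ) * (2 / π * x) := by rw [e1]; linarith
      _ ≤ N * Real.sin x := mul_le_mul_of_nonneg_left hsin hN.le
  · rw [min_eq_right hle] at hsin
    have hmin : ((min r (N - r) : ℕ) : ℝ) ≤ (N : ℝ) - r := by
      have h1 : min r (N - r) ≤ N - r := Nat.min_le_right _ _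
      have h2 : ((N - r : ℕ) : ℝ) = (N : ℝ) - r := by rw [Nat.cast_sub (by omega)]
      rw [← h2]
      exact_mod_cast h1
    calc ((min r (N - r) : ℕ) : ℝ) ≤ (N : ℝ) - r := hmin
      _ ≤ (N : ℝ) * (2 / π * (π - x)) := by rw [e2]; linarith
      _ ≤ N * Real.sin x := mul_le_mul_of_nonneg_left hsin hN.le

/-- The one-coordinate MAJORANT of the alias weight: `1` on the zero class, `val⁻² + (N − val)⁻²` (`≥ min(val, N−val)⁻²`) otherwise. -/
def wMaj (N : ℕ) (r : ZMod N) : ℝ :=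
  if r = 0 then 1 else ((r.val : ℝ) ^ 2)⁻¹ + ((((N - r.val : ℕ) : ℝ)) ^ 2)⁻¹

/-- [folklore] `0 ≤ wMaj N r`. -/
theorem wMaj_nonneg (N : ℕ) (r : ZMod N) : 0 ≤ wMaj N r := by
  unfold wMaj
  split_ifs
  · exact zero_le_one
  · positivity

/-- [folklore] `wMaj N 0 = 1`. -/
@[simp] theorem wMaj_zero (N : ℕ) : wMaj N (0 : ZMod N) = 1 := by simp [wMaj]

/-- [folklore] Every alias coordinate has weight `sinWt N k_{m,i} ≤ wMaj N (m i)` (`≤ 1` on the zero class; Jordan otherwise),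
for `|p_i| ≤ π`. -/
theorem sinWt_kfine_le_wMaj {N : ℕ} [NeZero N] {p : Fin D → ℝ} (hp : ∀ i, |p i| ≤ π) (m : Fin D → ZMod N) (i : Fin D) :
    sinWt N (kfine N p m i) ≤ wMaj N (m i) := by
  unfold wMaj
  split_ifs with h
  · exact sinWt_le_one _ _
  · have hv0 : 1 ≤ (m i).val := Nat.one_le_iff_ne_zero.2 fun h0 => h ((ZMod.val_eq_zero _).1 h0)
    have hvN : (m i).val + 1 ≤ N := ZMod.val_lt (m i)
    have hfold := fold_le_mul_abs_sin (hp i) hv0 hvN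
    have hf1 : 1 ≤ min (m i).val (N - (m i).val) := le_min hv0 (by omega)
    have hf0 : (0 : ℝ) < ((min (m i).val (N - (m i).val) : ℕ) : ℝ) := by exact_mod_cast hf1
    have hle : sinWt N (kfine N p m i) ≤ 1 / (((min (m i).val (N - (m i).val) : ℕ) : ℝ)) ^ 2 :=
      sinWt_le_inv_sq hf0 (by simpa [kfine] using hfold)
    refine hle.trans ?_
    -- 1/min(a,b)² ≤ 1/a² + 1/b²
    rcases Nat.le_total (m i).val (N - (m i).val) with hab | hab
    · rw [min_eq_left hab, one_div]
      exact le_add_of_nonneg_right (by positivity)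
    · rw [min_eq_right hab, one_div]
      exact le_add_of_nonneg_left (by positivity)

end Summit.QuantumFields.BalabanUV.Beta.GAN24.AliasWeights

end
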